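import Summits.ResolutionOfSingularities.ResolutionOfSingularities.Theorems.MaxContactCutSurfacePort
import Summits.ResolutionOfSingularities.ResolutionOfSingularities.Theorems.TauChainCutCells2
import HarnessLib

/-!
# MaxContactCutTauChainCut — decomp-res node «TauChainCut» (lens-4 g32 REV 2, critic row 186 CLEARED DECIDED +1 ·
MAP 0), tree file 5/5 of the node

Content VERBATIM from the decomp-res lens-4 g32 node REV 2 `HOME/decomp-res-lens-4/g32/TauChainCut_rev2.lean` (pin
d70c0cc0; imports the landed tree only, carries nothing); HOME = run/shared/lean/pub/decomp-res; critic row 186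
CLEARED DECIDED +1 · MAP 0; landing orders INBOX :984/:996 — provenance, critic text and the lens header in full in
the first file of the node, `TauChainLaw`.  Namespace `…Theorems.HugValuationCut`; `--supports
stmt-ResolutionOfSingularities-28338`.

## This file

THE §97 COROLLARIES GIVEN 31571 `MaxContactCut.NoContactHuggingTowers` BY NAME (in the Theses cone):
`noWildKangarooOffDoublePointTowers_iff_g32 (h71) (h640)` · `noWildKangarooOffLocusTowers_iff_g32` ·
`noWildPPowerOffLocusTowers_iff_g32` · `noWildContactFreeOffLocusTowers_iff_g32` — TREE ASIDE 28338 / the g23–g31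
residuals ⟺ the g32 located MIXED residual MODULO the port `SurfaceChainPort`, through `MaxContactCutSurfacePort`'s
`…_iff_g31 (h71) (h640)` family and `noWildNonSurfaceWallFreeFreshJumpShallowCompanionKangarooTowers_iff_g32`.
Imports `MaxContactCutSurfacePort` + `TauChainCutCells2`; 0 sorry.

[WRITER NOTE (decomp-res writer g12): file split only (tree files ≤ 400 lines); namespace, sections, section
variables / opens and every declaration exactly as in the lens (the node's global dupNamespace-linter line is
dropped — the library sets it; the `open …Theses` line lives only in the Theses-cone file
`MaxContactCutTauChainCut`; the lens's cone imports `MaxContactCutSatelliteCut` / `MaxContactCutWallCutCells` /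
`MaxContactCutSurfacePort` are confined to the cone file, the cone-free files import `SurfacePort` /
`SurfacePortCells` (⊇ the Wall / History / Depth cut cells they open) per rider (1)–(2)).]

(Sources: Hironaka1964 Ch. III (τ, directrix); Hironaka1970 / Giraud1975 (near points, τ-monotonicity);
CossartJannsenSaito2020 Thm. 6.40, Def. 6.38–6.39, Thm. 6.35 / Cor. 6.37, Ch. 8; Hauser2010Kangaroo;
HauserPerlega2019 §2; CossartPiltant2008 §2; CossartPiltant2019; Hironaka2005; Matsumura1987 §28; StacksProject 0804
/ 0BIQ / 031I.)
-/

noncomputable section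

open CategoryTheory AlgebraicGeometry IsLocalRing TopologicalSpace
open Literature.AlgebraicGeometry.Resolution
open Summit.ResolutionOfSingularities.ResolutionOfSingularities.Theses
open Summit.ResolutionOfSingularities.ResolutionOfSingularities.Theorems
open WeakOrderReduction ForcedTowerClasses DivergentTowerClasses MonomialTowerClasses
open HugDimensionClasses HugDimensionKernels SurfaceShadowClasses SurfaceShadowKernels
open NearPointCut (SingularClass)
open Scheme.IdealSheafData (vanishingIdeal)
open scoped BigOperators

namespace Summit.ResolutionOfSingularities.ResolutionOfSingularities.Theorems.HugValuationCut

section CurveCells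

variable {k : Type} [Field k]

/-- **GIVEN 31571 AND THE PORT: the g25 residual ⟺ the mixed residual.** [folklore] -/
theorem noWildKangarooOffDoublePointTowers_iff_g32 (h71 : MaxContactCut.NoContactHuggingTowers) (h640 : SurfaceChainPort) :
    NoWildKangarooOffDoublePointTowers ↔ NoWildMixedWallFreeFreshJumpShallowCompanionKangarooTowers :=
  (noWildKangarooOffDoublePointTowers_iff_g31 h71 h640).trans noWildNonSurfaceWallFreeFreshJumpShallowCompanionKangarooTowers_iff_g32

/-- **GIVEN 31571 AND THE PORT: g24's kangaroo residual ⟺ the mixed residual.** [folklore] -/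
theorem noWildKangarooOffLocusTowers_iff_g32 (h71 : MaxContactCut.NoContactHuggingTowers) (h640 : SurfaceChainPort) :
    NoWildKangarooOffLocusTowers ↔ NoWildMixedWallFreeFreshJumpShallowCompanionKangarooTowers :=
  (noWildKangarooOffLocusTowers_iff_g31 h71 h640).trans noWildNonSurfaceWallFreeFreshJumpShallowCompanionKangarooTowers_iff_g32

/-- **GIVEN 31571 AND THE PORT: g23's `p`-power residual ⟺ the mixed residual.** [folklore] -/
theorem noWildPPowerOffLocusTowers_iff_g32 (h71 : MaxContactCut.NoContactHuggingTowers) (h640 : SurfaceChainPort) :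
    NoWildPPowerOffLocusTowers ↔ NoWildMixedWallFreeFreshJumpShallowCompanionKangarooTowers :=
  (noWildPPowerOffLocusTowers_iff_g31 h71 h640).trans noWildNonSurfaceWallFreeFreshJumpShallowCompanionKangarooTowers_iff_g32

/-- **GIVEN 31571 AND THE PORT, THE TREE ASIDE 28338 ⟺ THE g32 RESIDUAL** — `NoWildContactFreeOffLocusTowers` ⟺ the
mixed wall-free
fresh-jump shallow companion-recurrent residual. [folklore] -/
theorem noWildContactFreeOffLocusTowers_iff_g32 (h71 : MaxContactCut.NoContactHuggingTowers) (h640 : SurfaceChainPort) :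
    NoWildContactFreeOffLocusTowers ↔ NoWildMixedWallFreeFreshJumpShallowCompanionKangarooTowers :=
  (noWildContactFreeOffLocusTowers_iff_g31 h71 h640).trans noWildNonSurfaceWallFreeFreshJumpShallowCompanionKangarooTowers_iff_g32

end CurveCells

end Summit.ResolutionOfSingularities.ResolutionOfSingularities.Theorems.HugValuationCut
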